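import Literature.Probability.RandomPlanarGeometry.RadialChordalConjugation
import Literature.Probability.RandomPlanarGeometry.SLEKappaRhoFlow
import Literature.Probability.RandomPlanarGeometry.SLETraceCriterionProofs
import HarnessLib

/-!
# The radial Loewner trace from the chordal one (Schramm–Wilson coordinate change, pathwise)

Topic `Probability/RandomPlanarGeometry`; one definition with body (`radialCurve`) and proved
theorems only (no named fact). Sequel of `RadialChordalConjugation`, which realises the radial
Loewner chain of a continuous driving function `V` (driving point `e^{iV}`, `RadialLoewner.Disc`),
read through the Cayley-type map `toDisc : ℍ → 𝔻`, as the chordal Loewner chain of the explicit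
driving function `W̌ = RadialChordal.cdrv` in half-plane capacity time `τ` (data built from the
radial Bessel flow `Y` of the marked boundary point `-1`). Here we transfer **generation by a
curve** from the chordal side to the radial side (`radialTrace_of_isGeneratedByCurve`): if a
continuous chordal driving function `U'` agrees with `W̌` on `[0, τ u₂]` (`u₂ < u₁`) and its chain
is generated by the curve `γ̌` (`Loewner.IsGeneratedByCurve`; e.g. almost every Brownian driving
function, Rohde–Schramm (2005), Thm. 5.1), then with `η = toDisc ∘ γ̌ ∘ τ`:

* `η` is continuous, `η₀ = 1`, `|η| ≤ 1`;
* for every radial time `u ≤ u₂`, **`RadialLoewner.Disc.domain V u` is the connected component of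
  `0` in `𝔻 ∖ η[0, u]`** (Lawler (2005), §6.4–6.5: "`D_t` is the connected component of
  `𝔻 ∖ γ[0, t]` containing the origin") — because the chordal domain is the component of `i` in
  `ℍ ∖ γ̌[0, τu]` (it is connected and is the union of the unbounded components), the target `i` is
  never swallowed (`0 ∈ D_u`), and components correspond under the homeomorphism `toDisc`;
* **the radial tip is the radial limit of the inverse radial map at the driving point**,
  `g_u⁻¹(r e^{iV_u}) → η_u` as `r ↑ 1` — from the chordal tip theorem
  `Loewner.IsGeneratedByCurve.tendsto_invFunOn_map` (Lawler (2005), Prop. 4.31 / Rem. 4.32)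
  composed with the Möbius maps (`RadialChordal.invFunOn_map_eq`).

Auxiliary: locality of chordal domains and inverse maps in the driving function
(`Loewner.domain_eq_of_eqOn`, `Loewner.invFunOn_map_eq_of_eqOn`, from the tree's
`Loewner.coe_lt_swallowingTime_of_eqOn` / `Loewner.map_eq_of_eqOn`), the topology of `toDisc`
(`image_toDisc_connectedComponentIn`, `image_toDisc_diff`), and
`Loewner.IsGeneratedByCurve.domain_eq_connectedComponentIn`.

## References

* O. Schramm, D. B. Wilson, *SLE coordinate changes*, New York J. Math. 11 (2005), 659–669, §4.
  [SchrammWilson2005]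
* G. F. Lawler, *Conformally Invariant Processes in the Plane*, AMS (2005), §4.1, §4.4
  (Prop. 4.31, Rem. 4.32), §6.4–6.5. [Lawler2005]
* S. Rohde, O. Schramm, *Basic properties of SLE*, Ann. of Math. 161 (2005), Thm. 4.1, Thm. 5.1.
  [RohdeSchramm2005]
-/

noncomputable section

open Complex Set Metric MeasureTheory Real Filter Topology
open UpperHalfPlane (upperHalfPlaneSet)
open scoped ComplexConjugate NNReal

namespace Literature.Probability.RandomPlanarGeometry

namespace RadialChordal

/-! ### Topology of the Cayley-type map -/

section CayleyTopology

/-- `toDisc` is continuous at every point of the closed upper half-plane. [folklore] -/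
theorem continuousAt_toDisc {z : ℂ} (hz : 0 ≤ z.im) : ContinuousAt toDisc z :=
  (continuous_const.sub continuous_id).continuousAt.div
    (continuous_const.add continuous_id).continuousAt (I_add_ne_zero hz)

/-- `toDisc` is continuous on the closed upper half-plane. [folklore] -/
theorem continuousOn_toDisc : ContinuousOn toDisc {z : ℂ | 0 ≤ z.im} := fun _ hz ↦
  (continuousAt_toDisc hz).continuousWithinAt

/-- `toHalf` is continuous at every point of the open unit disc. [folklore] -/
theorem continuousAt_toHalf {w : ℂ} (hw : ‖w‖ < 1) : ContinuousAt toHalf w :=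
  (continuous_const.mul (continuous_const.sub continuous_id)).continuousAt.div
    (continuous_const.add continuous_id).continuousAt (one_add_ne_zero hw)

/-- `toHalf` is continuous on the open unit disc. [folklore] -/
theorem continuousOn_toHalf : ContinuousOn toHalf (ball (0 : ℂ) 1) := fun _ hw ↦
  (continuousAt_toHalf (mem_ball_zero_iff.1 hw)).continuousWithinAt

/-- Points of the closed upper half-plane go to the closed unit disc. [folklore] -/
theorem norm_toDisc_le_one {z : ℂ} (hz : 0 ≤ z.im) : ‖toDisc z‖ ≤ 1 := by
  have hne : I + z ≠ 0 := I_add_ne_zero hz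
  rw [toDisc, norm_div, div_le_one (norm_pos_iff.2 hne)]
  have h : normSq (I - z) ≤ normSq (I + z) := by
    simp only [Complex.normSq_apply, Complex.sub_re, Complex.add_re, Complex.I_re, Complex.sub_im,
      Complex.add_im, Complex.I_im]
    nlinarith
  rw [Complex.normSq_eq_norm_sq, Complex.normSq_eq_norm_sq] at h
  exact le_of_pow_le_pow_left₀ two_ne_zero (norm_nonneg _) h

/-- `toDisc` is injective on the closed upper half-plane (indeed off its pole `-i`). [folklore] -/
theorem injOn_toDisc : InjOn toDisc {z : ℂ | 0 ≤ z.im} := by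
  intro z hz z' hz' h
  have := congrArg toHalf h
  rwa [toHalf_toDisc (I_add_ne_zero hz), toHalf_toDisc (I_add_ne_zero hz')] at this

/-- `toDisc` maps the open upper half-plane into the open disc. [folklore] -/
theorem mapsTo_toDisc : MapsTo toDisc upperHalfPlaneSet (ball (0 : ℂ) 1) := fun _ hz ↦
  mem_ball_zero_iff.2 (norm_toDisc_lt_one hz)

/-- `toHalf` maps the open disc into the open upper half-plane. [folklore] -/
theorem mapsTo_toHalf : MapsTo toHalf (ball (0 : ℂ) 1) upperHalfPlaneSet := fun _ hw ↦
  im_toHalf_pos (mem_ball_zero_iff.1 hw)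

/-- **Components correspond under the Cayley-type map**: for `A ⊆ ℍ` containing `i`,
`toDisc '' (component of i in A) = component of 0 in toDisc '' A`. [folklore] -/
theorem image_toDisc_connectedComponentIn {A : Set ℂ} (hA : A ⊆ upperHalfPlaneSet) (hi : I ∈ A) :
    toDisc '' connectedComponentIn A I = connectedComponentIn (toDisc '' A) 0 := by
  have hcontA : ContinuousOn toDisc A := continuousOn_toDisc.mono fun z hz ↦ (show 0 < z.im from hA hz).le
  have hBball : toDisc '' A ⊆ ball (0 : ℂ) 1 := image_subset_iff.2 fun z hz ↦ mapsTo_toDisc (hA hz)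
  have hcontB : ContinuousOn toHalf (toDisc '' A) := continuousOn_toHalf.mono hBball
  refine Subset.antisymm ?_ ?_
  · -- the image of the component of `i` is connected, contains `0`, lies in `toDisc '' A`
    have h1 : IsPreconnected (toDisc '' connectedComponentIn A I) :=
      isPreconnected_connectedComponentIn.image _ (hcontA.mono (connectedComponentIn_subset _ _))
    have h0 : (0 : ℂ) ∈ toDisc '' connectedComponentIn A I :=
      ⟨I, mem_connectedComponentIn hi, toDisc_I⟩
    exact h1.subset_connectedComponentIn h0 (image_mono (connectedComponentIn_subset _ _))
  · -- conversely pull the component of `0` back by `toHalf`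
    set T := connectedComponentIn (toDisc '' A) 0 with hT
    have hTB : T ⊆ toDisc '' A := connectedComponentIn_subset _ _
    have hT0 : (0 : ℂ) ∈ T := mem_connectedComponentIn ⟨I, hi, toDisc_I⟩
    have h1 : IsPreconnected (toHalf '' T) := isPreconnected_connectedComponentIn.image _ (hcontB.mono hTB)
    have h2 : I ∈ toHalf '' T := ⟨0, hT0, toHalf_zero⟩
    have h3 : toHalf '' T ⊆ A := by
      rintro _ ⟨w, hw, rfl⟩
      obtain ⟨z, hz, rfl⟩ := hTB hw
      rw [toHalf_toDisc (I_add_ne_zero (show 0 < z.im from hA hz).le)]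
      exact hz
    have h4 : toHalf '' T ⊆ connectedComponentIn A I := h1.subset_connectedComponentIn h2 h3
    intro w hw
    obtain ⟨z, hz, rfl⟩ := hTB hw
    have hzI : toHalf (toDisc z) = z := toHalf_toDisc (I_add_ne_zero (show 0 < z.im from hA hz).le)
    refine ⟨z, ?_, rfl⟩
    have : toHalf (toDisc z) ∈ connectedComponentIn A I := h4 ⟨toDisc z, hw, rfl⟩
    rwa [hzI] at this

/-- **The complement of a curve piece corresponds**: for a set `E` in the closed upper half-plane,
`toDisc '' (ℍ ∖ E) = 𝔻 ∖ toDisc '' E`. [folklore] -/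
theorem image_toDisc_diff {E : Set ℂ} (hE : E ⊆ {z : ℂ | 0 ≤ z.im}) :
    toDisc '' (upperHalfPlaneSet \ E) = ball (0 : ℂ) 1 \ toDisc '' E := by
  refine Subset.antisymm ?_ ?_
  · rintro _ ⟨z, ⟨hzH, hzE⟩, rfl⟩
    refine ⟨mapsTo_toDisc hzH, ?_⟩
    rintro ⟨z', hz'E, h⟩
    have : z' = z := injOn_toDisc (hE hz'E) (show 0 < z.im from hzH).le h
    exact hzE (this ▸ hz'E)
  · rintro w ⟨hw, hwE⟩
    have hw1 := mem_ball_zero_iff.1 hw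
    refine ⟨toHalf w, ⟨mapsTo_toHalf hw, fun h ↦ hwE ⟨toHalf w, h, toDisc_toHalf (one_add_ne_zero hw1)⟩⟩,
      toDisc_toHalf (one_add_ne_zero hw1)⟩

end CayleyTopology

/-! ### Chordal Loewner domains of chains generated by a curve, as components -/

section ChordalDomain

variable {W : ℝ≥0 → ℝ} {γ : ℝ≥0 → ℂ}

/-- **For a chain generated by a curve, the Loewner domain is the component of any of its points
in `ℍ ∖ γ[0, t]`** (it is connected, `Loewner.isPreconnected_domain`, and it is the union of the
unbounded components, `IsGeneratedByCurve.domain_eq`). [cite: Lawler2005, §4.4] -/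
theorem _root_.Literature.Probability.RandomPlanarGeometry.Loewner.IsGeneratedByCurve.domain_eq_connectedComponentIn
    (hγ : Loewner.IsGeneratedByCurve W γ) (hW : Continuous W) (t : ℝ≥0) {z : ℂ} (hz : z ∈ Loewner.domain W t) :
    Loewner.domain W t = connectedComponentIn (upperHalfPlaneSet \ γ '' Icc 0 t) z := by
  have hsub : Loewner.domain W t ⊆ upperHalfPlaneSet \ γ '' Icc 0 t := hγ.domain_subset_diff t
  refine Subset.antisymm ((Loewner.isPreconnected_domain hW t).subset_connectedComponentIn hz hsub) ?_
  intro y hy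
  rw [hγ.domain_eq, Loewner.unboundedComponent, mem_setOf_eq] at hz ⊢
  refine ⟨connectedComponentIn_subset _ _ hy, ?_⟩
  rw [← connectedComponentIn_eq hy]
  exact hz.2

end ChordalDomain


/-! ### Locality of the chordal chain in the driving function -/

section Locality

variable {W U : ℝ≥0 → ℝ}

/-- Drivers agreeing on `[0, t]` have the same Loewner domain at time `t`. [cite: Lawler2005, §4.1] -/
theorem _root_.Literature.Probability.RandomPlanarGeometry.Loewner.domain_eq_of_eqOn (hW : Continuous W)
    (hU : Continuous U) {t : ℝ≥0} (heq : ∀ s, s ≤ t → W s = U s) :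
    Loewner.domain U t = Loewner.domain W t := by
  ext z
  rw [Loewner.mem_domain_iff, Loewner.mem_domain_iff]
  exact ⟨fun h ↦ ⟨h.1, Loewner.coe_lt_swallowingTime_of_eqOn hU hW (fun s hs ↦ (heq s hs).symm) h.2⟩,
    fun h ↦ ⟨h.1, Loewner.coe_lt_swallowingTime_of_eqOn hW hU heq h.2⟩⟩

/-- Drivers agreeing on `[0, t]` have the same inverse Loewner map at time `t` on `ℍ`.
[cite: Lawler2005, §4.1] -/
theorem _root_.Literature.Probability.RandomPlanarGeometry.Loewner.invFunOn_map_eq_of_eqOn (hW : Continuous W)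
    (hU : Continuous U) {t : ℝ≥0} (heq : ∀ s, s ≤ t → W s = U s) {ω : ℂ} (hω : ω ∈ upperHalfPlaneSet) :
    Function.invFunOn (Loewner.map U t) (Loewner.domain U t) ω =
      Function.invFunOn (Loewner.map W t) (Loewner.domain W t) ω := by
  have hdom := Loewner.domain_eq_of_eqOn hW hU heq
  have hexW : ∃ z ∈ Loewner.domain W t, Loewner.map W t z = ω := (Loewner.surjOn_map hW t) hω
  have hexU : ∃ z ∈ Loewner.domain U t, Loewner.map U t z = ω := (Loewner.surjOn_map hU t) hω
  set x := Function.invFunOn (Loewner.map U t) (Loewner.domain U t) ω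
  set x' := Function.invFunOn (Loewner.map W t) (Loewner.domain W t) ω
  have hx : x ∈ Loewner.domain U t := Function.invFunOn_mem hexU
  have hxe : Loewner.map U t x = ω := Function.invFunOn_eq hexU
  have hx' : x' ∈ Loewner.domain W t := Function.invFunOn_mem hexW
  have hx'e : Loewner.map W t x' = ω := Function.invFunOn_eq hexW
  have hx'U : x' ∈ Loewner.domain U t := hdom ▸ hx'
  have hmap : Loewner.map U t x' = ω := by
    rw [Loewner.map_eq_of_eqOn hW hU heq ((Loewner.mem_domain_iff W t x').1 hx').2 le_rfl, hx'e]
  exact (Loewner.injOn_map hU t) hx hx'U (hxe.trans hmap.symm)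

end Locality

/-! ### The radial trace from the chordal one -/

section Trace

variable {Y : ℝ → ℝ} {u₁ : ℝ} {V : ℝ≥0 → ℝ}

/-- The **radial curve**: the chordal generating curve read in capacity time and mapped to the
disc, `η_s = toDisc (γ̌ (τ (s ∧ u₂)))` (frozen after the radial time `u₂`).
[cite: SchrammWilson2005, §4] -/
def radialCurve (Y : ℝ → ℝ) (u₁ : ℝ) (γ : ℝ≥0 → ℂ) (u₂ : ℝ≥0) (s : ℝ≥0) : ℂ :=
  toDisc (γ (clockNN Y u₁ (min s u₂)))

variable (hu₁ : 0 ≤ u₁) (hY : ContinuousOn Y (Icc 0 u₁)) (hYI : ∀ u ∈ Icc 0 u₁, Y u ∈ Ioo 0 (2 * π))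
include hu₁ hY hYI

/-- The clock in `ℝ≥0` is continuous. [folklore] -/
theorem continuous_clockNN : Continuous (clockNN Y u₁) :=
  continuous_real_toNNReal.comp ((continuous_clock hu₁ hY hYI).comp NNReal.continuous_coe)

/-- The clock in `ℝ≥0` is monotone. [folklore] -/
theorem monotone_clockNN : Monotone (clockNN Y u₁) := fun _ _ h ↦ by
  rw [← NNReal.coe_le_coe, coe_clockNN hu₁ hY hYI, coe_clockNN hu₁ hY hYI]
  exact (strictMono_clock hu₁ hY hYI).monotone (NNReal.coe_le_coe.2 h)

/-- `clockNN 0 = 0`. [folklore] -/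
theorem clockNN_zero : clockNN Y u₁ 0 = 0 := by
  rw [← NNReal.coe_eq_zero, coe_clockNN hu₁ hY hYI, NNReal.coe_zero, clock_zero]

/-- The clock maps `[0, u]` onto `[0, τ u]`. [folklore] -/
theorem image_clockNN_Icc (u : ℝ≥0) : clockNN Y u₁ '' Icc 0 u = Icc 0 (clockNN Y u₁ u) := by
  refine Subset.antisymm ?_ ?_
  · rintro _ ⟨s, hs, rfl⟩
    exact ⟨bot_le, monotone_clockNN hu₁ hY hYI hs.2⟩
  · intro t ht
    have hivt := intermediate_value_Icc (show (0 : ℝ≥0) ≤ u from bot_le)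
      (continuous_clockNN hu₁ hY hYI).continuousOn
    rw [clockNN_zero hu₁ hY hYI] at hivt
    exact hivt ht

/-- **The radial Loewner domain is the Cayley image of the chordal one**:
`D_u = toDisc '' Loewner.domain W̌ (τ u)` (`u < u₁`). [cite: SchrammWilson2005, §4] -/
theorem domain_eq_image_toDisc (hV : Continuous V)
    (hYeq : ∀ u ∈ Icc 0 u₁, Y u = π + (∫ s in (0 : ℝ)..u, Real.cot (Y s / 2)) - V u.toNNReal)
    {u : ℝ≥0} (hu : (u : ℝ) < u₁) :
    RadialLoewner.Disc.domain V u = toDisc '' Loewner.domain (cdrv Y u₁) (clockNN Y u₁ u) := by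
  rw [domain_cdrv_eq hu₁ hY hYI hV hYeq hu, image_image]
  refine Subset.antisymm (fun w hw ↦ ?_) ?_
  · have hw1 := mem_ball_zero_iff.1 (RadialLoewner.Disc.domain_subset V u hw)
    exact ⟨w, hw, toDisc_toHalf (one_add_ne_zero hw1)⟩
  · rintro _ ⟨w, hw, rfl⟩
    have hw1 := mem_ball_zero_iff.1 (RadialLoewner.Disc.domain_subset V u hw)
    change toDisc (toHalf w) ∈ _
    rwa [toDisc_toHalf (one_add_ne_zero hw1)]

/-- **The radial Loewner chain is locally generated by the Cayley image of the chordal trace.**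
Let `Y` solve the radial Bessel equation of the marked point `-1` on `[0, u₁]` for the continuous
radial driving function `V` with `V₀ = 0`, let `u₂ < u₁`, and let `U'` be a continuous chordal
driving function that agrees with the chordal driver `W̌ = cdrv` on `[0, τ u₂]` and whose chordal
Loewner chain is generated by a curve `γ̌` (`Loewner.IsGeneratedByCurve`). Then the radial curve
`η = toDisc ∘ γ̌ ∘ τ` is continuous, starts at `η₀ = 1`, lies in the closed disc, and for every
radial time `u ≤ u₂`: **the radial Loewner domain `D_u` (`RadialLoewner.Disc.domain V u`) is the
connected component of the origin in `𝔻 ∖ η[0, u]`**, and **the radial tip is the radial limit of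
the inverse radial map at the driving point**: `g_u⁻¹(r e^{iV_u}) → η_u` as `r ↑ 1`
(Lawler (2005), §6.5: "`D_t` is the connected component of `𝔻 ∖ γ[0,t]` containing the origin";
Schramm–Wilson (2005), §4; the chordal inputs are Lawler's Prop. 4.31 / Rem. 4.32 via
`Loewner.IsGeneratedByCurve.tendsto_invFunOn_map`). [cite: SchrammWilson2005, §4] -/
theorem radialTrace_of_isGeneratedByCurve (hV : Continuous V) (hV0 : V 0 = 0)
    (hYeq : ∀ u ∈ Icc 0 u₁, Y u = π + (∫ s in (0 : ℝ)..u, Real.cot (Y s / 2)) - V u.toNNReal)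
    {u₂ : ℝ≥0} (hu₂ : (u₂ : ℝ) < u₁) {U' : ℝ≥0 → ℝ} (hU' : Continuous U')
    (hagree : ∀ s, s ≤ clockNN Y u₁ u₂ → U' s = cdrv Y u₁ s) {γ : ℝ≥0 → ℂ}
    (hγ : Loewner.IsGeneratedByCurve U' γ) :
    Continuous (radialCurve Y u₁ γ u₂) ∧ radialCurve Y u₁ γ u₂ 0 = 1 ∧
      (∀ s, ‖radialCurve Y u₁ γ u₂ s‖ ≤ 1) ∧
      ∀ u : ℝ≥0, u ≤ u₂ →
        RadialLoewner.Disc.domain V u =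
          connectedComponentIn (ball (0 : ℂ) 1 \ radialCurve Y u₁ γ u₂ '' Icc 0 u) 0 ∧
        Tendsto (fun r : ℝ ↦ Function.invFunOn (RadialLoewner.Disc.map V u) (RadialLoewner.Disc.domain V u)
            ((r : ℂ) * Complex.exp ((V u : ℝ) * I)))
          (𝓝[<] 1) (𝓝 (radialCurve Y u₁ γ u₂ u)) := by
  have hWc := continuous_cdrv hu₁ hY hYI
  have hY0 : Y 0 = π := by
    have h := hYeq 0 ⟨le_rfl, hu₁⟩
    simp [hV0] at h
    exact h
  -- continuity, start, bound
  have hηc : Continuous (radialCurve Y u₁ γ u₂) := by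
    refine continuousOn_toDisc.comp_continuous
      (hγ.continuous.comp ((continuous_clockNN hu₁ hY hYI).comp (continuous_id.min continuous_const)))
      fun s ↦ hγ.im_nonneg _
  have hη0 : radialCurve Y u₁ γ u₂ 0 = 1 := by
    rw [radialCurve, min_eq_left (show (0 : ℝ≥0) ≤ u₂ from bot_le), clockNN_zero hu₁ hY hYI, hγ.apply_zero, hagree 0 bot_le,
      cdrv_zero hu₁ hY hYI hY0, Complex.ofReal_zero, toDisc_zero]
  have hηb : ∀ s, ‖radialCurve Y u₁ γ u₂ s‖ ≤ 1 := fun s ↦ norm_toDisc_le_one (hγ.im_nonneg _)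
  refine ⟨hηc, hη0, hηb, fun u hu ↦ ?_⟩
  have hu' : (u : ℝ) < u₁ := lt_of_le_of_lt (NNReal.coe_le_coe.2 hu) hu₂
  set t := clockNN Y u₁ u with ht
  have htt₂ : t ≤ clockNN Y u₁ u₂ := monotone_clockNN hu₁ hY hYI hu
  have hagree' : ∀ s, s ≤ t → cdrv Y u₁ s = U' s := fun s hs ↦ (hagree s (hs.trans htt₂)).symm
  -- `i = toHalf 0` is never swallowed
  have h0dom : (0 : ℂ) ∈ RadialLoewner.Disc.domain V u := RadialLoewner.Disc.zero_mem_domain V u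
  obtain ⟨hIdom, -⟩ := map_cdrv_toHalf hu₁ hY hYI hV hYeq hu' h0dom
  rw [toHalf_zero] at hIdom
  have hdomU : Loewner.domain U' t = Loewner.domain (cdrv Y u₁) t := Loewner.domain_eq_of_eqOn hWc hU' hagree'
  have hIdomU : I ∈ Loewner.domain U' t := hdomU ▸ hIdom
  -- the curve piece in capacity time
  have himage : radialCurve Y u₁ γ u₂ '' Icc 0 u = toDisc '' (γ '' Icc 0 t) := by
    have h1 : radialCurve Y u₁ γ u₂ '' Icc 0 u = (fun s ↦ toDisc (γ (clockNN Y u₁ s))) '' Icc 0 u := by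
      refine image_congr fun s hs ↦ ?_
      rw [radialCurve, min_eq_left (hs.2.trans hu)]
    rw [h1, ← image_clockNN_Icc hu₁ hY hYI u, image_image, image_image]
  constructor
  · -- the domain identity
    rw [domain_eq_image_toDisc hu₁ hY hYI hV hYeq hu', ← hdomU,
      hγ.domain_eq_connectedComponentIn hU' t hIdomU,
      image_toDisc_connectedComponentIn sdiff_subset ((hγ.domain_subset_diff t) hIdomU),
      image_toDisc_diff (image_subset_iff.2 fun s _ ↦ hγ.im_nonneg s), himage]
  · -- the tip
    set ζ := centre Y u₁ u
    set lam := lamb Y u₁ u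
    set ξ : ℂ := Complex.exp ((V u : ℝ) * I) with hξ
    have huI : (u : ℝ) ∈ Icc 0 u₁ := ⟨u.coe_nonneg, hu'.le⟩
    have hξm : ξ = moebius ζ lam (drv Y u₁ u) := by
      rw [hξ, moebius_drv_eq_exp hu₁ hYI hYeq huI, Real.toNNReal_coe]
    have hξ1 : ‖ξ‖ = 1 := by rw [hξ, Complex.norm_exp_ofReal_mul_I]
    have hWζ : (drv Y u₁ u : ℂ) - conj ζ ≠ 0 := by rw [conj_centre]; exact drv_sub_ccentre_ne_zero u
    have hζζ : ζ - conj ζ ≠ 0 := by rw [conj_centre]; exact centre_sub_ccentre_ne_zero u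
    -- the Möbius preimages of the radial approach points
    set p : ℝ → ℂ := fun r ↦ moebiusInv ζ lam ((r : ℂ) * ξ) with hp
    have hξl : ξ - lam ≠ 0 := by
      rw [hξm, moebius]
      intro h
      have h' : lam * ((drv Y u₁ u : ℂ) - ζ) / ((drv Y u₁ u : ℂ) - conj ζ) - lam =
          lam * (conj ζ - ζ) / ((drv Y u₁ u : ℂ) - conj ζ) := by
        field_simp; ring
      rw [h'] at h
      exact absurd h (div_ne_zero (mul_ne_zero (lamb_ne_zero u) (fun h ↦ hζζ (by linear_combination -h))) hWζ)
    have hpc : ContinuousAt p 1 := by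
      have h1 : ContinuousAt (fun r : ℝ ↦ (r : ℂ) * ξ) 1 := (Complex.continuous_ofReal.mul continuous_const).continuousAt
      have h2 : ContinuousAt (moebiusInv ζ lam) ξ :=
        ((continuous_const.mul continuous_id).sub continuous_const).continuousAt.div
          (continuous_id.sub continuous_const).continuousAt hξl
      exact h2.comp_of_eq h1 (by simp)
    have hp1 : p 1 = (U' t : ℂ) := by
      rw [hp]
      simp only [Complex.ofReal_one, one_mul]
      rw [hξm, moebiusInv_moebius (lamb_ne_zero u) hζζ hWζ, ← hagree' t le_rfl, ht,
        cdrv_clockNN hu₁ hY hYI hu'.le]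
    have hpH : ∀ r ∈ Ioo (0 : ℝ) 1, p r ∈ upperHalfPlaneSet := by
      intro r hr
      have hr1 : ‖(r : ℂ) * ξ‖ < 1 := by
        rw [norm_mul, hξ1, mul_one, Complex.norm_real, Real.norm_eq_abs, abs_of_pos hr.1]
        exact hr.2
      exact im_moebiusInv_pos hr1 u
    have hptend : Tendsto p (𝓝[<] 1) (𝓝[upperHalfPlaneSet] (U' t : ℂ)) := by
      refine tendsto_nhdsWithin_iff.2 ⟨?_, ?_⟩
      · rw [← hp1]
        exact hpc.tendsto.mono_left nhdsWithin_le_nhds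
      · have hmem : Ioo (0 : ℝ) 1 ∈ 𝓝[<] (1 : ℝ) := Ioo_mem_nhdsLT one_pos
        filter_upwards [hmem] with r hr using hpH r hr
    -- the chordal tip theorem, composed
    have htip := (hγ.tendsto_invFunOn_map hU' t).comp hptend
    have htoDisc := (continuousAt_toDisc (hγ.im_nonneg t)).tendsto.comp htip
    have hηu : radialCurve Y u₁ γ u₂ u = toDisc (γ t) := by rw [radialCurve, min_eq_left hu]
    rw [hηu]
    refine htoDisc.congr' ?_
    have hmem : Ioo (0 : ℝ) 1 ∈ 𝓝[<] (1 : ℝ) := Ioo_mem_nhdsLT one_pos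
    filter_upwards [hmem] with r hr
    have hr1 : ‖(r : ℂ) * ξ‖ < 1 := by
      rw [norm_mul, hξ1, mul_one, Complex.norm_real, Real.norm_eq_abs, abs_of_pos hr.1]
      exact hr.2
    simp only [Function.comp_apply]
    rw [invFunOn_map_eq hu₁ hY hYI hV hYeq hu' hr1,
      Loewner.invFunOn_map_eq_of_eqOn hWc hU' hagree' (hpH r hr)]

end Trace

end RadialChordal

end Literature.Probability.RandomPlanarGeometry
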